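import Summits.QuantumAdvantage.QuantumAdvantage.Theorems.PairFreezingC

/-! # PairFreezingD — part 4/8 (mechanical split for landing of `PairFreezing`; content verbatim; scopes re-opened with their variables) -/

set_option linter.dupNamespace false -- D-0017: single-problem summit ⇒ `QuantumAdvantage.QuantumAdvantage` by design
noncomputable section

namespace Summit.QuantumAdvantage.QuantumAdvantage.Theorems.PairFreezing
open Classical Finset Summit.QuantumAdvantage.AdviceFreeQNC0
open Literature.Computability.MetaComplexity Literature.Computability.MetaComplexity.Smolensky
open Literature.Computability.Complexity (parityFn)
open Summit.QuantumAdvantage.QuantumAdvantage.Theses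
open Summit.QuantumAdvantage.AdviceFreeQNC0.TransferWalk (wtPrefix_zero)
variable {n : ℕ}

namespace Pairing
variable (π : Pairing n)

section Occupation
variable (tab : Fin (n + 1) → Bool)


/-! #### one couple: regrouping the cube along the couple's four coordinates -/

section Couple

variable (b : ℕ) {k : ℕ} (hk : k < π.K tab)

/-- the four coordinates of couple `k`. -/
def q1 : Fin n := π.fst (π.ca tab ⟨k, hk⟩)
/-- Pair-freezing helper `q2` (lens-4 g4 machinery; see the enclosing section docstring). -/
def q2 : Fin n := π.snd (π.ca tab ⟨k, hk⟩)
/-- Pair-freezing helper `q3` (lens-4 g4 machinery; see the enclosing section docstring). -/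
def q3 : Fin n := π.fst (π.cd tab ⟨k, hk⟩)
/-- Pair-freezing helper `q4` (lens-4 g4 machinery; see the enclosing section docstring). -/
def q4 : Fin n := π.snd (π.cd tab ⟨k, hk⟩)

/-- Pair-freezing helper `q_distinct` (lens-4 g4 machinery; see the enclosing section docstring). -/
theorem q_distinct : π.q1 tab hk ≠ π.q2 tab hk ∧ π.q1 tab hk ≠ π.q3 tab hk ∧ π.q1 tab hk ≠ π.q4 tab hk ∧
    π.q2 tab hk ≠ π.q3 tab hk ∧ π.q2 tab hk ≠ π.q4 tab hk ∧ π.q3 tab hk ≠ π.q4 tab hk := by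
  have h := π.ca_val_lt_cd tab ⟨k, hk⟩
  unfold q1 q2 q3 q4
  refine ⟨?_, ?_, ?_, ?_, ?_, ?_⟩ <;> intro heq <;> have hv := congrArg Fin.val heq <;>
    simp only [fst_val, snd_val] at hv <;> omega

/-- Pair-freezing helper `q_vals` (lens-4 g4 machinery; see the enclosing section docstring). -/
theorem q_vals : (π.q1 tab hk).val = π.o + 2 * (π.ca tab ⟨k, hk⟩).val ∧ (π.q2 tab hk).val = π.o + 2 * (π.ca tab ⟨k, hk⟩).val + 1 ∧
    (π.q3 tab hk).val = π.o + 2 * (π.cd tab ⟨k, hk⟩).val ∧ (π.q4 tab hk).val = π.o + 2 * (π.cd tab ⟨k, hk⟩).val + 1 :=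
  ⟨rfl, rfl, rfl, rfl⟩

/-- is `x` one of the four coordinates of couple `k`? -/
def inQ (x : Fin n) : Prop := x = π.q1 tab hk ∨ x = π.q2 tab hk ∨ x = π.q3 tab hk ∨ x = π.q4 tab hk

/-- clear the four coordinates of couple `k`. -/
def clr (u : Fin n → Bool) : Fin n → Bool := fun x => if π.inQ tab hk x then false else u x

/-- set the four coordinates of couple `k`. -/
def set4 (w : Fin n → Bool) (a1 a2 d1 d2 : Bool) : Fin n → Bool := fun x =>
  if x = π.q1 tab hk then a1 else if x = π.q2 tab hk then a2 else if x = π.q3 tab hk then d1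
  else if x = π.q4 tab hk then d2 else w x

/-- Pair-freezing helper `set4_q1` (lens-4 g4 machinery; see the enclosing section docstring). -/
theorem set4_q1 (w : Fin n → Bool) (a1 a2 d1 d2 : Bool) : π.set4 tab hk w a1 a2 d1 d2 (π.q1 tab hk) = a1 := by
  simp [set4]
/-- Pair-freezing helper `set4_q2` (lens-4 g4 machinery; see the enclosing section docstring). -/
theorem set4_q2 (w : Fin n → Bool) (a1 a2 d1 d2 : Bool) : π.set4 tab hk w a1 a2 d1 d2 (π.q2 tab hk) = a2 := by
  have h := π.q_distinct tab hk
  simp [set4, h.1.symm]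
/-- Pair-freezing helper `set4_q3` (lens-4 g4 machinery; see the enclosing section docstring). -/
theorem set4_q3 (w : Fin n → Bool) (a1 a2 d1 d2 : Bool) : π.set4 tab hk w a1 a2 d1 d2 (π.q3 tab hk) = d1 := by
  have h := π.q_distinct tab hk
  simp [set4, h.2.1.symm, h.2.2.2.1.symm]
/-- Pair-freezing helper `set4_q4` (lens-4 g4 machinery; see the enclosing section docstring). -/
theorem set4_q4 (w : Fin n → Bool) (a1 a2 d1 d2 : Bool) : π.set4 tab hk w a1 a2 d1 d2 (π.q4 tab hk) = d2 := by
  have h := π.q_distinct tab hk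
  simp [set4, h.2.2.1.symm, h.2.2.2.2.1.symm, h.2.2.2.2.2.symm]
/-- Pair-freezing helper `set4_of_not` (lens-4 g4 machinery; see the enclosing section docstring). -/
theorem set4_of_not (w : Fin n → Bool) (a1 a2 d1 d2 : Bool) {x : Fin n} (hx : ¬ π.inQ tab hk x) :
    π.set4 tab hk w a1 a2 d1 d2 x = w x := by
  unfold inQ at hx
  push Not at hx
  simp [set4, hx.1, hx.2.1, hx.2.2.1, hx.2.2.2]

/-- Pair-freezing helper `clr_of_inQ` (lens-4 g4 machinery; see the enclosing section docstring). -/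
theorem clr_of_inQ (u : Fin n → Bool) {x : Fin n} (hx : π.inQ tab hk x) : π.clr tab hk u x = false := by
  simp [clr, hx]
/-- Pair-freezing helper `clr_of_not` (lens-4 g4 machinery; see the enclosing section docstring). -/
theorem clr_of_not (u : Fin n → Bool) {x : Fin n} (hx : ¬ π.inQ tab hk x) : π.clr tab hk u x = u x := by
  simp [clr, hx]

/-- Pair-freezing helper `clr_clr` (lens-4 g4 machinery; see the enclosing section docstring). -/
theorem clr_clr (u : Fin n → Bool) : π.clr tab hk (π.clr tab hk u) = π.clr tab hk u := by
  funext x; by_cases hx : π.inQ tab hk x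
  · rw [clr_of_inQ _ _ _ _ hx, clr_of_inQ _ _ _ _ hx]
  · rw [clr_of_not _ _ _ _ hx]

/-- Pair-freezing helper `clr_set4` (lens-4 g4 machinery; see the enclosing section docstring). -/
theorem clr_set4 (w : Fin n → Bool) (a1 a2 d1 d2 : Bool) : π.clr tab hk (π.set4 tab hk w a1 a2 d1 d2) = π.clr tab hk w := by
  funext x; by_cases hx : π.inQ tab hk x
  · rw [clr_of_inQ _ _ _ _ hx, clr_of_inQ _ _ _ _ hx]
  · rw [clr_of_not _ _ _ _ hx, clr_of_not _ _ _ _ hx, set4_of_not _ _ _ _ _ _ _ _ hx]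

/-- Pair-freezing helper `set4_clr_self` (lens-4 g4 machinery; see the enclosing section docstring). -/
theorem set4_clr_self (u : Fin n → Bool) :
    π.set4 tab hk (π.clr tab hk u) (u (π.q1 tab hk)) (u (π.q2 tab hk)) (u (π.q3 tab hk)) (u (π.q4 tab hk)) = u := by
  funext x
  by_cases hx : π.inQ tab hk x
  · rcases hx with rfl | rfl | rfl | rfl
    · exact π.set4_q1 tab hk _ _ _ _ _
    · exact π.set4_q2 tab hk _ _ _ _ _
    · exact π.set4_q3 tab hk _ _ _ _ _
    · exact π.set4_q4 tab hk _ _ _ _ _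
  · rw [set4_of_not _ _ _ _ _ _ _ _ hx, clr_of_not _ _ _ _ hx]

/-- coordinates in the couple lie at or above `o + 2·ca`. -/
theorem inQ_val {x : Fin n} (hx : π.inQ tab hk x) : π.o + 2 * (π.ca tab ⟨k, hk⟩).val ≤ x.val := by
  have h := π.ca_val_lt_cd tab ⟨k, hk⟩
  have hv := π.q_vals tab hk
  rcases hx with rfl | rfl | rfl | rfl <;> omega

/-- **prefix independence**: the potential of the first `k` couples does not see the bits of couple `k`. -/
theorem Psi_clr (u : Fin n → Bool) : π.Psi tab b (π.clr tab hk u) k = π.Psi tab b u k := by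
  unfold Psi
  refine prod_congr rfl fun j hj => ?_
  rw [mem_filter] at hj
  have hjk : j.val < k := hj.2
  have hlt : (π.cd tab j).val < (π.ca tab ⟨k, hk⟩).val := π.cd_lt_ca tab (j' := ⟨k, hk⟩) hjk
  have hlt' := π.ca_val_lt_cd tab j
  have agree : ∀ x : Fin n, x.val < π.o + 2 * (π.cd tab j).val + 2 → π.clr tab hk u x = u x := by
    intro x hx
    refine π.clr_of_not tab hk u fun hq => ?_
    have := π.inQ_val tab hk hq
    omega
  have h1 : (π.ca tab j ∈ π.relB tab b (π.clr tab hk u)) ↔ (π.ca tab j ∈ π.relB tab b u) :=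
    π.mem_relB_congr tab b (π.ca tab j) fun x hx => agree x (by omega)
  have h2 : (π.cd tab j ∈ π.relB tab b (π.clr tab hk u)) ↔ (π.cd tab j ∈ π.relB tab b u) :=
    π.mem_relB_congr tab b (π.cd tab j) fun x hx => agree x hx
  unfold psi goodB
  rw [Bool.decide_congr h1, Bool.decide_congr h2]

/-- the finite heart: weights `1` (good) / `2` (bad) over the 16 settings of a couple sum to at most `28`, whatever the
two residues `x` (first pair) and `y` (second pair, before the first pair's bits are added). -/
def cwt (g : Bool) : ℕ := if g = true then 1 else 2

/-- Pair-freezing helper `goodc` (lens-4 g4 machinery; see the enclosing section docstring). -/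
def goodc (x y : ℕ) (a1 a2 d1 d2 : Bool) : Bool :=
  ((a1 != a2) && !decide (x % 3 = 1)) || ((d1 != d2) && !decide ((y + a1.toNat + a2.toNat) % 3 = 1))

/-- Pair-freezing helper `sum16_le` (lens-4 g4 machinery; see the enclosing section docstring). -/
theorem sum16_le (x y : ℕ) :
    (∑ a1 : Bool, ∑ a2 : Bool, ∑ d1 : Bool, ∑ d2 : Bool, cwt (goodc x y a1 a2 d1 d2)) ≤ 28 := by
  have key : ∀ x' < 3, ∀ y' < 3, (∑ a1 : Bool, ∑ a2 : Bool, ∑ d1 : Bool, ∑ d2 : Bool,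
      cwt (((a1 != a2) && !decide (x' % 3 = 1)) ||
        ((d1 != d2) && !decide ((y' + a1.toNat + a2.toNat) % 3 = 1)))) ≤ 28 := by
    simp only [Fintype.sum_bool]
    decide
  have h := key (x % 3) (Nat.mod_lt _ (by norm_num)) (y % 3) (Nat.mod_lt _ (by norm_num))
  have hg : ∀ a1 a2 d1 d2 : Bool, goodc x y a1 a2 d1 d2 =
      (((a1 != a2) && !decide (x % 3 % 3 = 1)) ||
        ((d1 != d2) && !decide ((y % 3 + a1.toNat + a2.toNat) % 3 = 1))) := by
    intro a1 a2 d1 d2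
    unfold goodc
    rw [Nat.mod_mod, show (y + a1.toNat + a2.toNat) % 3 = (y % 3 + a1.toNat + a2.toNat) % 3 by omega]
  simp only [hg]
  exact h

/-- on the fibre of `w` (a point with the couple's bits cleared), the couple potential is the finite weight table. -/
theorem psi_set4 {w : Fin n → Bool} (hw : π.clr tab hk w = w) (a1 a2 d1 d2 : Bool) :
    π.psi tab b (π.set4 tab hk w a1 a2 d1 d2) ⟨k, hk⟩ =
      cwt (goodc (b + 2 * (π.ca tab ⟨k, hk⟩).val + wtPrefix w (π.o + 2 * (π.ca tab ⟨k, hk⟩).val))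
        (b + 2 * (π.cd tab ⟨k, hk⟩).val + wtPrefix w (π.o + 2 * (π.cd tab ⟨k, hk⟩).val)) a1 a2 d1 d2) := by
  have hP := π.le
  have hlt := π.ca_val_lt_cd tab ⟨k, hk⟩
  have hv := π.q_vals tab hk
  have hdis := π.q_distinct tab hk
  set u := π.set4 tab hk w a1 a2 d1 d2 with hu
  -- bits of `w` in the couple are `false`
  have hw1 : w (π.q1 tab hk) = false := by rw [← hw]; exact π.clr_of_inQ tab hk w (Or.inl rfl)
  have hw2 : w (π.q2 tab hk) = false := by rw [← hw]; exact π.clr_of_inQ tab hk w (Or.inr (Or.inl rfl))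
  -- prefix weights of `u`
  have hWa : wtPrefix u (π.o + 2 * (π.ca tab ⟨k, hk⟩).val) = wtPrefix w (π.o + 2 * (π.ca tab ⟨k, hk⟩).val) :=
    wtPrefix_congr w u 0 _ (Nat.zero_le _) (by omega) (by rw [wtPrefix_zero, wtPrefix_zero]) fun x _ hx =>
      π.set4_of_not tab hk w a1 a2 d1 d2 fun hq => by have := π.inQ_val tab hk hq; omega
  have hq1n : π.o + 2 * (π.ca tab ⟨k, hk⟩).val < n := (π.q1 tab hk).isLt
  have hq2n : π.o + 2 * (π.ca tab ⟨k, hk⟩).val + 1 < n := (π.q2 tab hk).isLt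
  have hWa2 : wtPrefix u (π.o + 2 * (π.ca tab ⟨k, hk⟩).val + 2) =
      wtPrefix w (π.o + 2 * (π.ca tab ⟨k, hk⟩).val + 2) + a1.toNat + a2.toNat := by
    rw [wtPrefix_succ u hq2n, wtPrefix_succ u hq1n, wtPrefix_succ w hq2n, wtPrefix_succ w hq1n, hWa]
    have e1 : u ⟨π.o + 2 * (π.ca tab ⟨k, hk⟩).val, hq1n⟩ = a1 := by
      have : (⟨π.o + 2 * (π.ca tab ⟨k, hk⟩).val, hq1n⟩ : Fin n) = π.q1 tab hk := Fin.ext (by rw [hv.1])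
      rw [this]; exact π.set4_q1 tab hk w a1 a2 d1 d2
    have e2 : u ⟨π.o + 2 * (π.ca tab ⟨k, hk⟩).val + 1, hq2n⟩ = a2 := by
      have : (⟨π.o + 2 * (π.ca tab ⟨k, hk⟩).val + 1, hq2n⟩ : Fin n) = π.q2 tab hk := Fin.ext (by rw [hv.2.1])
      rw [this]; exact π.set4_q2 tab hk w a1 a2 d1 d2
    have e3 : w ⟨π.o + 2 * (π.ca tab ⟨k, hk⟩).val, hq1n⟩ = false := by
      have : (⟨π.o + 2 * (π.ca tab ⟨k, hk⟩).val, hq1n⟩ : Fin n) = π.q1 tab hk := Fin.ext (by rw [hv.1])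
      rw [this]; exact hw1
    have e4 : w ⟨π.o + 2 * (π.ca tab ⟨k, hk⟩).val + 1, hq2n⟩ = false := by
      have : (⟨π.o + 2 * (π.ca tab ⟨k, hk⟩).val + 1, hq2n⟩ : Fin n) = π.q2 tab hk := Fin.ext (by rw [hv.2.1])
      rw [this]; exact hw2
    rw [e1, e2, e3, e4]
    cases a1 <;> cases a2 <;> simp
  have hWd : wtPrefix u (π.o + 2 * (π.cd tab ⟨k, hk⟩).val) =
      wtPrefix w (π.o + 2 * (π.cd tab ⟨k, hk⟩).val) + a1.toNat + a2.toNat := by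
    have h := wtPrefix_add_congr w u (π.o + 2 * (π.ca tab ⟨k, hk⟩).val + 2) (π.o + 2 * (π.cd tab ⟨k, hk⟩).val)
      (by omega) (by omega) fun x h1 h2 =>
        π.set4_of_not tab hk w a1 a2 d1 d2 fun hq => by
          rcases hq with rfl | rfl | rfl | rfl <;> omega
    rw [hWa2] at h
    omega
  -- evaluate the membership conditions
  have hm1 : (π.ca tab ⟨k, hk⟩ ∈ π.relB tab b u) ↔
      ((a1 != a2) && !decide ((b + 2 * (π.ca tab ⟨k, hk⟩).val +
        wtPrefix w (π.o + 2 * (π.ca tab ⟨k, hk⟩).val)) % 3 = 1)) = true := by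
    unfold relB
    rw [mem_filter]
    have e1 : u (π.fst (π.ca tab ⟨k, hk⟩)) = a1 := π.set4_q1 tab hk w a1 a2 d1 d2
    have e2 : u (π.snd (π.ca tab ⟨k, hk⟩)) = a2 := π.set4_q2 tab hk w a1 a2 d1 d2
    rw [e1, e2, hWa]
    simp only [mem_univ, true_and, π.ca_mem tab]
    cases a1 <;> cases a2 <;> simp
  have hm2 : (π.cd tab ⟨k, hk⟩ ∈ π.relB tab b u) ↔
      ((d1 != d2) && !decide ((b + 2 * (π.cd tab ⟨k, hk⟩).val +
        wtPrefix w (π.o + 2 * (π.cd tab ⟨k, hk⟩).val) + a1.toNat + a2.toNat) % 3 = 1)) = true := by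
    unfold relB
    rw [mem_filter]
    have e1 : u (π.fst (π.cd tab ⟨k, hk⟩)) = d1 := π.set4_q3 tab hk w a1 a2 d1 d2
    have e2 : u (π.snd (π.cd tab ⟨k, hk⟩)) = d2 := π.set4_q4 tab hk w a1 a2 d1 d2
    rw [e1, e2, hWd, show b + 2 * (π.cd tab ⟨k, hk⟩).val + (wtPrefix w (π.o + 2 * (π.cd tab ⟨k, hk⟩).val) +
        a1.toNat + a2.toNat) = b + 2 * (π.cd tab ⟨k, hk⟩).val + wtPrefix w (π.o + 2 * (π.cd tab ⟨k, hk⟩).val) +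
        a1.toNat + a2.toNat by ring]
    simp only [mem_univ, true_and, π.cd_mem tab]
    cases d1 <;> cases d2 <;> simp
  unfold psi goodB goodc cwt
  rw [Bool.decide_congr hm1, Bool.decide_congr hm2]
  simp only [Bool.decide_eq_true]

/-- the fibre of `w` under `clr` (for `w` cleared) is the 16-point image of `set4 w`. -/
theorem fibre_eq {w : Fin n → Bool} (hw : π.clr tab hk w = w) :
    (univ.filter fun u => π.clr tab hk u = w) =
      (univ : Finset (Bool × Bool × Bool × Bool)).image
        fun s => π.set4 tab hk w s.1 s.2.1 s.2.2.1 s.2.2.2 := by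
  ext u
  simp only [mem_filter, mem_univ, true_and, mem_image]
  constructor
  · intro hu
    refine ⟨⟨u (π.q1 tab hk), u (π.q2 tab hk), u (π.q3 tab hk), u (π.q4 tab hk)⟩, ?_⟩
    have h := π.set4_clr_self tab hk u
    rw [hu] at h
    exact h
  · rintro ⟨s, rfl⟩
    rw [clr_set4, hw]

/-- Pair-freezing helper `set4_injective` (lens-4 g4 machinery; see the enclosing section docstring). -/
theorem set4_injective (w : Fin n → Bool) :
    Function.Injective fun s : Bool × Bool × Bool × Bool => π.set4 tab hk w s.1 s.2.1 s.2.2.1 s.2.2.2 := by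
  rintro ⟨a1, a2, d1, d2⟩ ⟨a1', a2', d1', d2'⟩ h
  have h1 := congrFun h (π.q1 tab hk)
  have h2 := congrFun h (π.q2 tab hk)
  have h3 := congrFun h (π.q3 tab hk)
  have h4 := congrFun h (π.q4 tab hk)
  simp only [set4_q1, set4_q2, set4_q3, set4_q4] at h1 h2 h3 h4
  simp [h1, h2, h3, h4]

/-- fibre count and fibre potential: `16 · Σ_{fibre(w)} ψ_k ≤ 28 · #fibre(w)` for every `w`. -/
theorem fibre_bound (w : Fin n → Bool) :
    16 * (∑ u ∈ (univ.filter fun u => π.clr tab hk u = w), π.psi tab b u ⟨k, hk⟩) ≤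
      28 * (univ.filter fun u => π.clr tab hk u = w).card := by
  by_cases hw : π.clr tab hk w = w
  · rw [π.fibre_eq tab hk hw, sum_image fun s _ s' _ h => π.set4_injective tab hk w h,
      card_image_of_injective _ (π.set4_injective tab hk w)]
    simp only [Fintype.sum_prod_type, card_univ, Fintype.card_prod, Fintype.card_bool]
    have h := sum16_le (b + 2 * (π.ca tab ⟨k, hk⟩).val + wtPrefix w (π.o + 2 * (π.ca tab ⟨k, hk⟩).val))
      (b + 2 * (π.cd tab ⟨k, hk⟩).val + wtPrefix w (π.o + 2 * (π.cd tab ⟨k, hk⟩).val))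
    simp only [π.psi_set4 tab b hk hw]
    omega
  · have hempty : (univ.filter fun u => π.clr tab hk u = w) = ∅ := by
      refine filter_eq_empty_iff.mpr fun u _ hu => hw ?_
      rw [← hu, clr_clr]
    rw [hempty]
    simp

include hk in
/-- **one couple step**: `16 · Σ_u Ψ_{k+1}(u) ≤ 28 · Σ_u Ψ_k(u)`. -/
theorem Psi_step : 16 * ∑ u : Fin n → Bool, π.Psi tab b u (k + 1) ≤ 28 * ∑ u : Fin n → Bool, π.Psi tab b u k := by
  have hL : ∑ u : Fin n → Bool, π.Psi tab b u (k + 1) =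
      ∑ w : Fin n → Bool, π.Psi tab b w k *
        ∑ u ∈ (univ.filter fun u => π.clr tab hk u = w), π.psi tab b u ⟨k, hk⟩ := by
    rw [← Finset.sum_fiberwise (univ : Finset (Fin n → Bool)) (π.clr tab hk) fun u => π.Psi tab b u (k + 1)]
    refine sum_congr rfl fun w _ => ?_
    rw [mul_sum]
    refine sum_congr rfl fun u hu => ?_
    rw [mem_filter] at hu
    rw [π.Psi_succ tab b u hk, ← hu.2, π.Psi_clr tab b hk u]
  have hR : ∑ u : Fin n → Bool, π.Psi tab b u k =
      ∑ w : Fin n → Bool, π.Psi tab b w k * (univ.filter fun u => π.clr tab hk u = w).card := by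
    rw [← Finset.sum_fiberwise (univ : Finset (Fin n → Bool)) (π.clr tab hk) fun u => π.Psi tab b u k]
    refine sum_congr rfl fun w _ => ?_
    rw [card_eq_sum_ones, mul_sum]
    refine sum_congr rfl fun u hu => ?_
    rw [mem_filter] at hu
    rw [mul_one, ← hu.2, π.Psi_clr tab b hk u]
  rw [hL, hR, mul_sum, mul_sum]
  refine sum_le_sum fun w _ => ?_
  have h := π.fibre_bound tab b hk w
  calc 16 * (π.Psi tab b w k * ∑ u ∈ (univ.filter fun u => π.clr tab hk u = w), π.psi tab b u ⟨k, hk⟩)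
      = π.Psi tab b w k * (16 * ∑ u ∈ (univ.filter fun u => π.clr tab hk u = w), π.psi tab b u ⟨k, hk⟩) := by ring
    _ ≤ π.Psi tab b w k * (28 * (univ.filter fun u => π.clr tab hk u = w).card) := Nat.mul_le_mul_left _ h
    _ = 28 * (π.Psi tab b w k * (univ.filter fun u => π.clr tab hk u = w).card) := by ring

end Couple

/-- the potential bound: `16^k · Σ_u Ψ_k(u) ≤ 28^k · 2ⁿ`. -/
theorem Psi_sum_le (b : ℕ) : ∀ k ≤ π.K tab, 16 ^ k * ∑ u : Fin n → Bool, π.Psi tab b u k ≤ 28 ^ k * 2 ^ n := by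
  intro k hk
  induction k with
  | zero =>
    simp only [pow_zero, one_mul, Psi_zero, sum_const, card_univ, Fintype.card_fun, Fintype.card_bool,
      Fintype.card_fin, smul_eq_mul, mul_one]
    exact le_rfl
  | succ k ih =>
    have hk' : k < π.K tab := by omega
    have h1 := ih (by omega)
    have h2 := π.Psi_step tab b hk'
    calc 16 ^ (k + 1) * ∑ u : Fin n → Bool, π.Psi tab b u (k + 1)
        = 16 ^ k * (16 * ∑ u : Fin n → Bool, π.Psi tab b u (k + 1)) := by ring
      _ ≤ 16 ^ k * (28 * ∑ u : Fin n → Bool, π.Psi tab b u k) := Nat.mul_le_mul_left _ h2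
      _ = 28 * (16 ^ k * ∑ u : Fin n → Bool, π.Psi tab b u k) := by ring
      _ ≤ 28 * (28 ^ k * 2 ^ n) := Nat.mul_le_mul_left _ h1
      _ = 28 ^ (k + 1) * 2 ^ n := by ring

/-- **occupation bound for a fixed residue**: `#{u : N_b(u) < M} · 32^K ≤ 2^M · 28^K · 2ⁿ`. -/
theorem occupation_b (b M : ℕ) :
    (univ.filter fun u : Fin n → Bool => π.Nb tab b u < M).card * 32 ^ π.K tab ≤ 2 ^ M * 28 ^ π.K tab * 2 ^ n := by
  have hpot := π.Psi_sum_le tab b (π.K tab) le_rfl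
  have hpt : ∀ u : Fin n → Bool, π.Nb tab b u < M → 2 ^ π.K tab ≤ 2 ^ M * π.Psi tab b u (π.K tab) := by
    intro u hu
    rw [← π.Psi_full_mul tab b u, mul_comm]
    exact Nat.mul_le_mul_right _ (Nat.pow_le_pow_right (by norm_num) hu.le)
  have h1 : (univ.filter fun u : Fin n → Bool => π.Nb tab b u < M).card * 2 ^ π.K tab ≤
      2 ^ M * ∑ u : Fin n → Bool, π.Psi tab b u (π.K tab) := by
    rw [card_eq_sum_ones, sum_mul, mul_sum]
    calc ∑ u ∈ (univ.filter fun u : Fin n → Bool => π.Nb tab b u < M), 1 * 2 ^ π.K tab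
        ≤ ∑ u ∈ (univ.filter fun u : Fin n → Bool => π.Nb tab b u < M), 2 ^ M * π.Psi tab b u (π.K tab) := by
          refine sum_le_sum fun u hu => ?_
          rw [mem_filter] at hu
          rw [one_mul]; exact hpt u hu.2
      _ ≤ ∑ u : Fin n → Bool, 2 ^ M * π.Psi tab b u (π.K tab) :=
          sum_le_sum_of_subset_of_nonneg (filter_subset _ _) fun _ _ _ => Nat.zero_le _
  have h32 : (32 : ℕ) ^ π.K tab = 2 ^ π.K tab * 16 ^ π.K tab := by rw [← mul_pow]; norm_num
  rw [h32, ← mul_assoc]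
  calc (univ.filter fun u : Fin n → Bool => π.Nb tab b u < M).card * 2 ^ π.K tab * 16 ^ π.K tab
      ≤ 2 ^ M * (∑ u : Fin n → Bool, π.Psi tab b u (π.K tab)) * 16 ^ π.K tab := Nat.mul_le_mul_right _ h1
    _ = 2 ^ M * (16 ^ π.K tab * ∑ u : Fin n → Bool, π.Psi tab b u (π.K tab)) := by ring
    _ ≤ 2 ^ M * (28 ^ π.K tab * 2 ^ n) := Nat.mul_le_mul_left _ hpot
    _ = 2 ^ M * 28 ^ π.K tab * 2 ^ n := by ring

/-- **THE OCCUPATION BOUND**: `#{u : #Rel(u) < M} · 32^K ≤ 3 · 2^M · 28^K · 2ⁿ`. -/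
theorem occupation (c M : ℕ) :
    (univ.filter fun u : Fin n → Bool => (π.rel c tab u).card < M).card * 32 ^ π.K tab ≤
      3 * (2 ^ M * 28 ^ π.K tab * 2 ^ n) := by
  have hsub : (univ.filter fun u : Fin n → Bool => (π.rel c tab u).card < M) ⊆
      (range 3).biUnion fun b => univ.filter fun u : Fin n → Bool => π.Nb tab b u < M := by
    intro u hu
    rw [mem_filter] at hu
    rw [mem_biUnion]
    refine ⟨(c + π.o + 1 + wt u) % 3, mem_range.2 (Nat.mod_lt _ (by norm_num)), ?_⟩
    rw [mem_filter]
    refine ⟨mem_univ _, lt_of_le_of_lt (π.Nb_le_card_relB tab _ u) ?_⟩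
    rw [← rel_eq_relB]
    exact hu.2
  calc (univ.filter fun u : Fin n → Bool => (π.rel c tab u).card < M).card * 32 ^ π.K tab
      ≤ ((range 3).biUnion fun b => univ.filter fun u : Fin n → Bool => π.Nb tab b u < M).card * 32 ^ π.K tab :=
        Nat.mul_le_mul_right _ (card_le_card hsub)
    _ ≤ (∑ b ∈ range 3, (univ.filter fun u : Fin n → Bool => π.Nb tab b u < M).card) * 32 ^ π.K tab :=
        Nat.mul_le_mul_right _ card_biUnion_le
    _ = ∑ b ∈ range 3, (univ.filter fun u : Fin n → Bool => π.Nb tab b u < M).card * 32 ^ π.K tab := by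
        rw [sum_mul]
    _ ≤ ∑ b ∈ range 3, 2 ^ M * 28 ^ π.K tab * 2 ^ n := sum_le_sum fun b _ => π.occupation_b tab b M
    _ = 3 * (2 ^ M * 28 ^ π.K tab * 2 ^ n) := by rw [sum_const, card_range, smul_eq_mul]

end Occupation
end Pairing
end Summit.QuantumAdvantage.QuantumAdvantage.Theorems.PairFreezing
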